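import Mathlib
import HarnessLib
import Summits.Parity.GeneralizedHardyLittlewood.Theorems.LeeYangFibresModelHyperbolicityDefs
import Literature.NumberTheory.Sieve.EulerMascheroniEin

/-!
# Route `LeeYangFibres`, crux `AbsoluteUpgrade` (stmt-Parity-14116), line `dip-margin-rate-exchange`:
# vocabulary of the ADJOINT METHOD for `ModGammaDisc` (lead seat c1, cycle 1)

Route-posited objects and STATEMENTS (D-0016 `<Route><Crux>Defs` file; nothing asserted) for the proof of
the registered stub `stub_modGammaDisc : ModGammaDisc` (`LeeYangFibresAbsoluteUpgradeDipDefs.lean`) — the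
mod-Gamma disc asymptotic `Σ_{j<u} I_{j+1}(u) z^j = e^{-γz}(u-1)^z/Γ(1+z) + O_K(|(u-1)^z|/u)` of the
Buchstab–Dickman row — by the REAL-VARIABLE adjoint method of the sieve literature (Iwaniec; Greaves 2001
§4.2; the tree's `Literature/NumberTheory/Sieve/SieveAdjointP.lean`, `EulerMascheroniEin.lean`,
`DelayEquationDecay.lean` are the `x^z`-free templates), instead of Laplace inversion:

* The row as a function of `v = τ − 1`, `K(v) := G_u(v+1; z) = Σ_{j<u} I_{j+1}(v+1) z^j` (`rowFn`, built on
  the tree's `modelEval`), satisfies `K ≡ 1` on `[0, 1]` and the delay equation `v K'(v) = z K(v−1)` on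
  `(1, u]` (tree: `DensityCalculus` (C2), (C6)).
* Its ADJOINT equation is `(v g(v))' = −z g(v+1)`; for `Re z > −1` it is solved by the Laplace-type integral
  `g_z(v) = e^{γz} ∫_0^∞ e^{−vx} x^z e^{−z Ein(x)} dx` (kernel `x h' = z e^{−x} h`), and then
  `⟨K, g⟩(v) := v K(v) g(v) + z ∫_{v−1}^{v} K(t) g(t+1) dt` is CONSTANT in `v ≥ 1`, equal to
  `lim_{t→0⁺} t g_z(t) = 1` (initial-value computation with the tree's `Ein = γ + log + E₁`,
  `Literature.NumberTheory.Sieve.ein_eq_add`, and `E₁ → 0`).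
* To cover the whole disc `|z| ≤ K+1` one regularises at `x = 0`: with `φ_z(x) := e^{−z Ein(x)}` (entire in
  `x`, via the complex `einC`), its Taylor data `p_k(z)` and remainder `R_N`,
  `g_z(v) = e^{γz}[Σ_{k<N} p_k(z) Γ(z+k+1) v^{−z−k−1} + ∫_0^∞ e^{−vx} x^{z+N} R_N(z,x) dx]`, and the
  `Γ`-NORMALISED adjoint `g̃_z := g_z/Γ(1+z)` (`adjTilde`) is ENTIRE in `z` on `Re z > −N−1`
  (`Γ(z+k+1)/Γ(z+1) = (z+1)⋯(z+k)`; at `z = −j` it is a polynomial in `v`), still solves the adjoint equation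
  (analytic continuation in `z`), has the explicit Watson asymptotics `v g̃_z(v) = e^{γz} v^{−z}(1 + O_K(1/v))`,
  and `⟨K, g̃⟩ ≡ 1/Γ(1+z)`.
* Hence `v K(v) g̃(v) = 1/Γ(1+z) − z ∫_{v−1}^{v} K g̃(·+1)`; a continuous induction
  (`Literature.NumberTheory.Sieve.bounded_of_forall_lt_half_add_half`) gives the a-priori bound
  `|K_z(v)| ≤ B v^{Re z}`, and dividing by `v g̃(v)` gives `ModGammaDisc`.

Objects: `einKernelC`, `einC`, `phiZ`, `pCoeff`, `remZ`, `adjTilde`, `rowFn`.  Statements (stub types):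
`MGEin`, `MGAdjointEq`, `MGAdjointAsymp`, `MGInvariantValue`, `MGInvariantConst`.  The one proved theorem
below is `rowFn_eq_one` (the initial segment), a sanity check of the vocabulary.

Lead's numerics supporting the target expansion including its first correction
(`Lines/dip-margin-rate-exchange-lead-c1.md` §1, §5): `F_u(z)/M(z) − 1 ≈ z²/(u−1)` — measured `0.0112` vs
`0.25/23 = 0.0109` at `z = ±½`, `u = 24`.

References: Greaves 2001 §4.2 (adjoint functions of the sieve delay equations) [Greaves2001]; de Bruijn 1950
(Buchstab's function); Alladi 1982 [Alladi1982]; Tenenbaum III.5–III.6 [Tenenbaum2015].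
-/

noncomputable section

namespace Summit.Parity.GeneralizedHardyLittlewood.Cruxes.AbsoluteUpgrade.DipMarginRateExchange

open scoped BigOperators
open MeasureTheory Set
open Summit.Parity.GeneralizedHardyLittlewood.Cruxes.ModelHyperbolicity.WindowChainTransport (cellDensity modelEval)
open Literature.NumberTheory.Sieve (ein)

/-! ## Objects -/

/-- The entire kernel `∫_0^1 e^{−xu} du` (`= (1 − e^{−x})/x` for `x ≠ 0`, `= 1` at `0`), complex argument;
the complexification of the tree's `Literature.NumberTheory.Sieve.einKernel`. -/
def einKernelC (x : ℂ) : ℂ := ∫ u in (0 : ℝ)..1, Complex.exp (-(x * u))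

/-- The entire exponential integral `Ein(x) = ∫_0^1 (1 − e^{−xt})/t dt = x ∫_0^1 einKernelC (x t) dt
= Σ_{k≥1} (−1)^{k+1} x^k/(k·k!)`, complex argument; on `ℝ` it is the tree's
`Literature.NumberTheory.Sieve.ein` (statement `MGEin`). -/
def einC (x : ℂ) : ℂ := x * ∫ t in (0 : ℝ)..1, einKernelC (x * t)

/-- `φ_z(x) := exp(−z Ein(x))`, entire in `x` for each `z` (the non-oscillatory part of the adjoint kernel
`x^z e^{−z Ein(x)} = e^{−z(γ + E₁(x))}`). -/
def phiZ (z x : ℂ) : ℂ := Complex.exp (-(z * einC x))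

/-- Taylor coefficients of `φ_z` at `0`: `p_k(z) = φ_z^{(k)}(0)/k!` (`p_0 = 1`, `p_1 = −z`,
`p_2 = z²/2 + z/4`, …; a polynomial in `z` of degree `k`). -/
def pCoeff (z : ℂ) (k : ℕ) : ℂ := ((k.factorial : ℂ))⁻¹ * iteratedDeriv k (phiZ z) 0

/-- Taylor remainder of order `N`: `φ_z(x) = Σ_{k<N} p_k(z) x^k + x^N · remZ N z x` for `x ≠ 0`
(junk `… / 0` at `x = 0`). -/
def remZ (N : ℕ) (z x : ℂ) : ℂ :=
  (phiZ z x - ∑ k ∈ Finset.range N, pCoeff z k * x ^ k) / x ^ N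

/-- **The regularised, `Γ`-normalised adjoint** `g̃_z(v)` (`N`-th order regularisation at `x = 0`; for
`Re z > −1` it equals `e^{γz} Γ(1+z)⁻¹ ∫_0^∞ e^{−vx} x^z e^{−z Ein(x)} dx`):
`g̃_z(v) = e^{γz} [ Σ_{k<N} p_k(z) (z+1)(z+2)⋯(z+k) v^{−(z+k+1)} + Γ(1+z)⁻¹ ∫_0^∞ e^{−vx} x^{z+N} R_N(z,x) dx ]`
(real `v > 0`; principal powers of the positive reals `v`, `x`; Mathlib's `(Complex.Gamma (1+z))⁻¹ = 0` at
`z = −1, −2, …` is the correct value of the entire `1/Γ(1+z)`, and there `g̃_{−j}` is a polynomial in `v` of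
degree `j − 1`). -/
def adjTilde (N : ℕ) (z : ℂ) (v : ℝ) : ℂ :=
  Complex.exp ((Real.eulerMascheroniConstant : ℂ) * z) *
    ((∑ k ∈ Finset.range N,
        pCoeff z k * (∏ i ∈ Finset.range k, (z + ((i : ℂ) + 1))) * ((v : ℂ) ^ (-(z + ((k : ℂ) + 1))))) +
      (Complex.Gamma (1 + z))⁻¹ *
        ∫ x in Ioi (0 : ℝ), Complex.exp (-((v : ℂ) * x)) * ((x : ℂ) ^ (z + (N : ℂ))) * remZ N z (x : ℂ))

/-- The Buchstab–Dickman row as a function of `v = τ − 1`: `K(v) = G_u(v+1; z) = Σ_{j<u} I_{j+1}(v+1) z^j`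
(the tree's `modelEval`); `ModGammaDisc` is about `K(u−1) = modelEval u u z`. -/
def rowFn (u : ℕ) (z : ℂ) (v : ℝ) : ℂ := modelEval u (v + 1) z

/-! ## Statements (types of the registered stubs of the adjoint method; nothing is asserted) -/

/-- **The complex `Ein`**: `einC` is entire, agrees with the tree's real `ein` on `ℝ`, and
`|einC x| ≤ |x| e^{|x|}` (so `|φ_z(x)| ≤ exp(|z| |x| e^{|x|})`, the sup bound fed to Cauchy–Taylor,
`Literature.Analysis.Complex.norm_sub_taylor_le_of_forall_mem_ball`). Line statement (type of the registered
stub `mg_ein`). -/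
def MGEin : Prop :=
  Differentiable ℂ einC ∧ (∀ x : ℝ, einC (x : ℂ) = ((ein x : ℝ) : ℂ)) ∧
    ∀ x : ℂ, ‖einC x‖ ≤ ‖x‖ * Real.exp ‖x‖

/-- **The adjoint equation** for the regularised normalised adjoint: for `N ≥ 1`, `|z| ≤ N − 1` and
`v > 0`, `d/dv [v g̃_z(v)] = −z g̃_z(v+1)` (for `Re z > −1` an integration by parts on
`x ↦ e^{−vx} x^{z+1} e^{−zEin(x)}` using `x h' = z e^{−x} h`, `h = x^z e^{−z Ein x}`; in general by analytic
continuation in `z`, every ingredient of `adjTilde` being analytic in `z` on `Re z > −N−1`). Line statement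
(type of the registered stub `mg_adjointEq : MGEin → MGAdjointEq`). -/
def MGAdjointEq : Prop :=
  ∀ N : ℕ, 1 ≤ N → ∀ z : ℂ, ‖z‖ ≤ (N : ℝ) - 1 → ∀ v : ℝ, 0 < v →
    HasDerivAt (fun w : ℝ => (w : ℂ) * adjTilde N z w) (-z * adjTilde N z (v + 1)) v

/-- **Watson asymptotics of the adjoint**, uniformly on the disc: for `N ≥ 1` there are `C, v₀` with
`|v g̃_z(v) − e^{γz} v^{−z}| ≤ (C/v) |v^{−z}|` for `v ≥ v₀`, `|z| ≤ N − 1` (the `k = 0` term of `adjTilde` is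
`v^{−z−1}` since `p_0 = 1`; the `k ≥ 1` terms and the remainder integral — `|R_N| ≤ C_N` uniformly by
Cauchy–Taylor near `0` and `|φ_z(x)| ≤ C x^{|z|}` for `x ≥ 1` — are `O(|v^{−z}|/v²)`). Line statement (type of
the registered stub `mg_adjointAsymp : MGEin → MGAdjointAsymp`). -/
def MGAdjointAsymp : Prop :=
  ∀ N : ℕ, 1 ≤ N → ∃ C : ℝ, ∃ v₀ : ℝ, 0 < v₀ ∧ ∀ v : ℝ, v₀ ≤ v → ∀ z : ℂ, ‖z‖ ≤ (N : ℝ) - 1 →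
    ‖(v : ℂ) * adjTilde N z v -
        Complex.exp ((Real.eulerMascheroniConstant : ℂ) * z) * ((v : ℂ) ^ (-z))‖ ≤
      C / v * ‖(v : ℂ) ^ (-z)‖

/-- **The invariant's value** (initial-value theorem): for `N ≥ 1` and `|z| ≤ N − 1`,
`g̃_z(1) + z ∫_0^1 g̃_z(t+1) dt = 1/Γ(1+z)` (by the adjoint equation the left side is `lim_{t→0⁺} t g̃_z(t)`;
for `Re z > −1`, `t g_z(t) = e^{γz}∫_0^∞ e^{−y}(y/t)^z e^{−zEin(y/t)} dy → e^{γz}e^{−γz} = 1` because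
`(y/t)^z e^{−z Ein(y/t)} = e^{−z(γ + E₁(y/t))}` (tree `ein_eq_add`) and `E₁ → 0`; extend to the disc by
analyticity in `z`). Line statement (type of the registered stub
`mg_invariantValue : MGEin → MGAdjointEq → MGInvariantValue`). -/
def MGInvariantValue : Prop :=
  ∀ N : ℕ, 1 ≤ N → ∀ z : ℂ, ‖z‖ ≤ (N : ℝ) - 1 →
    adjTilde N z 1 + z * ∫ t in (0 : ℝ)..1, adjTilde N z (t + 1) = (Complex.Gamma (1 + z))⁻¹

/-- **Constancy of the invariant along the row**: for `N ≥ 1`, `|z| ≤ N − 1`, `u ≥ 3` and `1 ≤ v ≤ u − 1`,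
`v K(v) g̃_z(v) + z ∫_{v−1}^{v} K(t) g̃_z(t+1) dt = g̃_z(1) + z ∫_0^1 g̃_z(t+1) dt`
(`K = rowFn u z`; differentiate: `K[(v g̃)' + z g̃(v+1)] = 0` by the adjoint equation and `v K' = z K(v−1)`
from `DensityCalculus` (C6) — tree `WindowChainTransport.stub_calculus`; the right side is the value at
`v = 1`, where `K ≡ 1` on `[0,1]`, `rowFn_eq_one`). Line statement (type of the registered stub
`mg_invariantConst : MGAdjointEq → MGInvariantConst`). -/
def MGInvariantConst : Prop :=
  ∀ N : ℕ, 1 ≤ N → ∀ z : ℂ, ‖z‖ ≤ (N : ℝ) - 1 → ∀ u : ℕ, 3 ≤ u → ∀ v : ℝ, 1 ≤ v → v ≤ (u : ℝ) - 1 →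
    (v : ℂ) * rowFn u z v * adjTilde N z v +
        z * ∫ t in (v - 1)..v, rowFn u z t * adjTilde N z (t + 1) =
      adjTilde N z 1 + z * ∫ t in (0 : ℝ)..1, adjTilde N z (t + 1)

/-! ## Sanity (proved): the initial segment of the row -/

/-- `K ≡ 1` on `(−∞, 1]` (in particular on the initial window `[0, 1]`): `rowFn u z v = 1` for `v ≤ 1` and `u ≥ 1` (all densities above `I_1 ≡ 1`
vanish on `τ ≤ 2`, tree `cellDensity_succ_of_le_two`). -/
theorem rowFn_eq_one : ∀ u : ℕ, 1 ≤ u → ∀ z : ℂ, ∀ v : ℝ, v ≤ 1 → rowFn u z v = 1 := by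
  intro u hu z v hv1
  unfold rowFn modelEval
  have h2 : v + 1 ≤ 2 := by linarith
  rw [Finset.sum_eq_single_of_mem 0 (Finset.mem_range.mpr (by omega))]
  · simp [Summit.Parity.GeneralizedHardyLittlewood.Cruxes.ModelHyperbolicity.WindowChainTransport.cellDensity_zero]
  · intro j _ hj
    obtain ⟨k, rfl⟩ := Nat.exists_eq_succ_of_ne_zero hj
    rw [Summit.Parity.GeneralizedHardyLittlewood.Cruxes.ModelHyperbolicity.WindowChainTransport.cellDensity_succ_of_le_two
      k h2]
    simp

end Summit.Parity.GeneralizedHardyLittlewood.Cruxes.AbsoluteUpgrade.DipMarginRateExchange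

end
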